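import Summits.CriticalPhenomena.CardyFormulaZ2.Theses.CardyMeckeFlip
import Literature.Probability.Percolation.QuadCrossingSubseqLimits
import Literature.Probability.Percolation.QuadCrossingContinuityEventsProofs
import Literature.Probability.Percolation.QuadCrossingNullFrontier
import Summits.CriticalPhenomena.CardyFormulaZ2.Theorems.CardyMeckeFlipZ2LimitsSymmetricIsometryOfRotation
import Summits.CriticalPhenomena.CardyFormulaZ2.Theorems.CardyMeckeFlipZ2LimitsSymmetricSelfDualMarginalsOf
import Summits.CriticalPhenomena.CardyFormulaZ2.Theorems.CardyMeckeFlipZ2LimitsSymmetricLatticeRSWQuads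
import Summits.CriticalPhenomena.CardyFormulaZ2.Theorems.CardyMeckeFlipZ2LimitsSymmetricOneQuadDualityGe
import Summits.CriticalPhenomena.CardyFormulaZ2.Theorems.CardyMeckeFlipZ2LimitsSymmetricCrossedEventEqOfSides
import Summits.CriticalPhenomena.CardyFormulaZ2.Theorems.CardyMeckeFlipZ2LimitsSymmetricDualExclusion

/-!
# Birth skeleton (BC3) for crux `Z2LimitsSymmetric` (stmt-CriticalPhenomena-14827)

Route `CardyMeckeFlip`, sub-problem `CardyFormulaZ2`; skeleton registrar
`planner-skel-stmt-CriticalPhenomena-14827-0`, 2026-08-17.  Tree path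
`Summits/CriticalPhenomena/CardyFormulaZ2/Cruxes/Z2LimitsSymmetric/Lines/birth.lean`.

The crux (rank 5, "the non-flip hypotheses of `MeckeRigidity`"): every subsequential quad-crossing
scaling limit `μ ∈ Λ = subseqQuadLimits univ` of critical bond percolation on `δℤ²` (Schramm–Smirnov
space `ℋ_ℂ = QuadConfig univ`) is (P) a probability law, (E2) invariant under every isometry of `ℂ`,
(D) exactly self-dual on finite-dimensional crossing marginals, (RSW) gives every `3a × a` rectangle
quad (short sides `0`/`2`) probability `≥ c > 0` for one `c`.

## RESHAPE 1 (lead prover-line-stmt-CriticalPhenomena-14827-c1-0, 2026-08-17): S3 split into four registered stubs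

`stub_selfDualMarginals` (L) is now DERIVED (no sorry) from S3a `stub_dualExclusion` (lattice-level
exclusion primal crossing / shifted-dual crossing of the transpose), S3b `stub_oneQuadDualityGe`
(`1 ≤ μ(⊞_Q) + μ(⊞_{Q†})` for charted quads, from the tree's `prob_not_crossed_le_z2QuadLaw` + closed-set
portmanteau + shrink continuity), S3d `stub_crossedEvent_eq_of_sides` (`⊞_Q` depends only on carrier and
sides) and S3e `stub_selfDualMarginals_of` (the coupling/total-variation assembly: S3a → S3b → S3d → S3).
S1 stays the crux's cited debt (its conditional form `stub_rotationInvariantLimits_of_dkkmo` LANDED, p143406).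
Skeleton stubs now: S1, S2, S4, S3a, S3b, S3d, S3e (= 7 = stubs_max).
STATE after cycle 1: the ONLY remaining `sorry` is S1 = DKKMO's theorem (cited debt); the assembled crux
modulo S1 / modulo `dkkmo_theorem_1_2_schrammSmirnov` is `Theorems/CardyMeckeFlipZ2LimitsSymmetric.lean`
(`Z2LimitsSymmetric_of_rotationInvariance`, `Z2LimitsSymmetric_of_dkkmo`, `Z2LimitsSymmetric_iff_rotationInvariance`).
LANDED (sorry replaced by the tree theorem) — EVERY stub except S1: S2 `stub_isometryOfRotation` (p143913),
S3e `stub_selfDualMarginals_of` (p144074), S4 `stub_latticeRSWQuads` (p144137), S3b `stub_oneQuadDualityGe` (p144300),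
S3d `stub_crossedEvent_eq_of_sides` (p144302), S3a `stub_dualExclusion` (p144354); S1's conditional form `stub_rotationInvariantLimits_of_dkkmo` (p143406).

## The line (birth): four registered stubs, one per genuinely missing INPUT (sorries ONLY inside `stub_*`)

What the tree already has: (P) `isProbabilityMeasure_of_isSubseqQuadLimit` (QuadCrossingSubseqLimits);
translation invariance of sublimits PROVED (`…Cruxes.LagHandOff.CrosscutDictionary.stub_translationInput`);
rotation invariance of sublimits CONDITIONAL on `dkkmo_theorem_1_2_schrammSmirnov`
(`Theorems/CardySelfRefinementRotationInput.lean`); Schramm–Smirnov Lemma 5.1 PROVED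
(`SchrammSmirnov2011_lemma_5_1_holds`) and Cor. 5.2 (`tendsto_measure_of_null_frontier_generateFrom`);
`rsw_half_holds` PROVED; `QuadConfig.hasOuterApproxClosed` (portmanteau on the metrisable `ℋ_ℂ`).
Hence the stubs (signatures written out in full, self-contained under
`open Literature.Probability.Percolation.QuadCrossing in`, so that a `--supports` proof can restate them verbatim):

* S1 `stub_rotationInvariantLimits` (XL) — DKKMO in ℋ-form; verbatim item stmt-CriticalPhenomena-10270.
* S2 `stub_isometryOfRotation` (M) — for `μ ∈ Λ`, rotation invariance ⇒ invariance under all of `E(2)`.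
* S3 `stub_selfDualMarginals` (L) — duality of f.d. crossing marginals in the limit.
* S4 `stub_latticeRSWQuads` (M) — lattice RSW for `3a × a` rectangle quads, eventually in the mesh, ONE constant.

## The composition `Z2LimitsSymmetric_of` (sorry-free; concludes the crux BY NAME)

(P) is the tree theorem; (E2) is S2 fed with S1; (D) is S3; (RSW) is S4 pushed through the closed-set
half of the portmanteau theorem (`le_measureReal_crossedEvent_of_eventually`, proved below: along the
defining meshes `δₖ → 0⁺` of `μ` the bound holds eventually, `⊞_Q` is closed in `𝒯`, and
`FiniteMeasure.limsup_measure_closed_le_of_tendsto` gives `c ≤ limsup μ_{δₖ}(⊞_Q) ≤ μ(⊞_Q)`).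

BC3 (planner folder `bc/`): `lean check` rc 0, sorries = 4 = stubs; for each stub `X`, the probes
`X → Z2LimitsSymmetric` and `X → CardyFormulaZ2` by `first | exact? | simpa [X] | (unfold X; simpa) | aesop`
all FAIL (8/8), the control `Z2LimitsSymmetric → Z2LimitsSymmetric` succeeds.
Disproof used: none on file for this crux (no `Cruxes/Z2LimitsSymmetric/Disproof.lean` at registration).
-/

noncomputable section

open MeasureTheory Filter Set Topology
open scoped ENNReal NNReal
open Literature.Probability.Percolation Literature.Probability.Percolation.QuadCrossing

namespace Summit.CriticalPhenomena.CardyFormulaZ2.Cruxes.Z2LimitsSymmetric.Birth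

/-! ### Registered stubs (signatures written out in full) -/

/-- **S1 — `stub_rotationInvariantLimits` (XL): rotation invariance of `ℤ²` sublimits (DKKMO, ℋ-form).**
Every `μ ∈ Λ` is invariant under every rotation `z ↦ e^{iα} z` (`isometryLaw (rotation e^{iα}) μ = μ`).
VERBATIM the shared item `CardySelfRefinement.RotationInput` = `CardyMaterialLaw.RotationInput`
(stmt-CriticalPhenomena-10270; `Iff.rfl`, checked), proved in tree CONDITIONALLY on the named fact
`dkkmo_theorem_1_2_schrammSmirnov` (DKKMO arXiv:2012.11672 Thm 1.2, `d_SS` half, `q = 1`):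
`Theorems/CardySelfRefinementRotationInput.lean`, `rotationInput_of_dkkmo_theorem_1_2_schrammSmirnov`. -/
theorem stub_rotationInvariantLimits :
    open Literature.Probability.Percolation.QuadCrossing in ∀ μ ∈ subseqQuadLimits (Set.univ : Set ℂ), ∀ α : ℝ,
      isometryLaw (rotation (Circle.exp α)).toIsometryEquiv μ = μ := by
  sorry

/-- **S2 — `stub_isometryOfRotation` (M): for `ℤ²` sublimits, rotation invariance upgrades to full `E(2)`
invariance.**  Translations: lattice translations + `δ → 0` (PROVED in tree:
`Cruxes.LagHandOff.CrosscutDictionary.stub_translationInput`, `Theorems/CardySelfRefinementLagHandOffTranslation.lean`);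
the reflection `z ↦ z̄`: exact lattice symmetry (`z2QuadLaw_map_conj`) + continuity of the push-forward +
uniqueness of weak limits (`ℋ_ℂ` metrisable, Schramm–Smirnov Thm 1.4 (1), in tree); generation of `E(2)` by
translations, rotations about `0` and `z ↦ z̄` (Mazur–Ulam `IsometryEquiv.toRealLinearIsometryEquivOfMapZero` +
`linear_isometry_complex`), the action being a homomorphism by measurable maps (`QuadConfig.mapHomeomorph_trans`,
`Measure.map_map`). -/
theorem stub_isometryOfRotation :
    open Literature.Probability.Percolation.QuadCrossing in ∀ μ ∈ subseqQuadLimits (Set.univ : Set ℂ),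
      (∀ α : ℝ, isometryLaw (rotation (Circle.exp α)).toIsometryEquiv μ = μ) →
      ∀ g : ℂ ≃ᵢ ℂ, MeasureTheory.Measure.map (QuadConfig.isometry g)
        ((μ : MeasureTheory.FiniteMeasure (QuadConfig (Set.univ : Set ℂ))) :
          MeasureTheory.Measure (QuadConfig (Set.univ : Set ℂ))) =
        ((μ : MeasureTheory.FiniteMeasure (QuadConfig (Set.univ : Set ℂ))) :
          MeasureTheory.Measure (QuadConfig (Set.univ : Set ℂ))) :=
  Summit.CriticalPhenomena.CardyFormulaZ2.Cruxes.Z2LimitsSymmetric.stub_isometryOfRotation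

/-- **S3a — `stub_dualExclusion` (M/L): lattice-level exclusion.**  For `δ > 0`, every bond
configuration `ω`, a quad `Q` and a transposed quad `Qt` (same carrier, `∂₀Qt = ∂₁Q`, `∂₂Qt = ∂₃Q`):
if `Q ∈ S_ω` (an open primal crossing of `Q`) then `Qt` is NOT crossed by the TRUE dual picture — the
Schramm–Smirnov configuration of `dualConfig ω` drawn on `δℤ²` and translated by the half-mesh vector
`(δ/2)(1+i)` (dual vertex `u` = the face with lower-left corner `u`).  Proof: chart `Q` by
`Quad.exists_straighten`, `inter_nonempty_of_crossing_continua` in the chart, and the arithmetic fact that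
the drawn open primal edges and the shifted drawn open dual edges are disjoint (a shifted dual edge meets
only the primal edge it is dual to, which is then closed). -/
theorem stub_dualExclusion :
    open Literature.Probability.Percolation.QuadCrossing in ∀ (δ : ℝ), 0 < δ → ∀ (ω : Literature.Probability.Percolation.BondConfig (Literature.Probability.LatticeModels.Site 2)) (Q Qt : Quad (Set.univ : Set ℂ)), Qt.carrier = Q.carrier → Qt.side 0 = Q.side 1 → Qt.side 2 = Q.side 3 → Q ∈ Literature.Probability.Percolation.z2QuadConfig (Set.univ : Set ℂ) δ ω → Qt ∉ QuadConfig.translate (((δ / 2 : ℝ) : ℂ) * (1 + Complex.I)) (Literature.Probability.Percolation.z2QuadConfig (Set.univ : Set ℂ) δ (Literature.Probability.Percolation.dualConfig ω)) :=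
  Summit.CriticalPhenomena.CardyFormulaZ2.Cruxes.Z2LimitsSymmetric.stub_dualExclusion

/-- **S3b — `stub_oneQuadDualityGe` (M): one-quad duality in the limit, the `≥` half.**  For `μ ∈ Λ`
and a plane homeomorphism `H`, with `Q = rectQuad H 1 1` (crossed `H(left) ↔ H(right)`) and its transpose
`Q† = rectQuad (rotI.trans H) 1 1` (crossed `H(bottom) ↔ H(top)`): `1 ≤ μ(⊞_Q) + μ(⊞_{Q†})`.  Lattice:
`P[Q†⁺ ∉ S_ω] ≤ μ_δ(⊞_{Q⁻})` (`prob_not_crossed_le_z2QuadLaw`, tree: no open crossing of the harder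
transpose ⇒ the dual configuration crosses an easier version of `Q`; its law is `μ_δ` again), i.e.
`1 ≤ μ_δ(⊞_{Q†⁺}) + μ_δ(⊞_{Q⁻})`; closed-set portmanteau along the defining meshes; `⊞_{Q†⁺} ⊆ ⊞_{Q†}`
(`strictlyDominated_rectQuad`) and `μ(⊞_{Q⁻}) ↓ μ(⊞_Q)` (`exists_shrink_measure_crossedEvent_le`). -/
theorem stub_oneQuadDualityGe :
    open Literature.Probability.Percolation.QuadCrossing in ∀ μ ∈ Literature.Probability.Percolation.QuadCrossing.subseqQuadLimits (Set.univ : Set ℂ), ∀ H : ℂ ≃ₜ ℂ, (1 : ENNReal) ≤ ((μ : MeasureTheory.FiniteMeasure (QuadConfig (Set.univ : Set ℂ))) : MeasureTheory.Measure (QuadConfig (Set.univ : Set ℂ))) (QuadConfig.crossedEvent (Quad.rectQuad H 1 1 one_pos one_pos (fun _ => Set.mem_univ _))) + ((μ : MeasureTheory.FiniteMeasure (QuadConfig (Set.univ : Set ℂ))) : MeasureTheory.Measure (QuadConfig (Set.univ : Set ℂ))) (QuadConfig.crossedEvent (Quad.rectQuad ((Homeomorph.mulLeft₀ Complex.I Complex.I_ne_zero).trans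 H) 1 1 one_pos one_pos (fun _ => Set.mem_univ _))) :=
  Summit.CriticalPhenomena.CardyFormulaZ2.Cruxes.Z2LimitsSymmetric.stub_oneQuadDualityGe

/-- **S3d — `stub_crossedEvent_eq_of_sides` (M): crossing events depend only on the carrier and the four
sides.**  Two parametrised quads with the same carrier and the same sides differ by a side-preserving
reparametrisation `k` of the square (both are homeomorphisms of the compact square onto the common
carrier); and `Q ∈ S ↔ Q.reparam k ∈ S` for every closed lower `S` (chart `Q = rectQuad H 1 1`; the
strictly smaller `rectQuad H (1-s) (1+s)`, reparametrised, are `< Q`, lie in `S`, and converge to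
`Q.reparam k`; `S` is closed).  (`QuadCrossingReparam.lean` deliberately stops short of this.) -/
theorem stub_crossedEvent_eq_of_sides :
    open Literature.Probability.Percolation.QuadCrossing in ∀ (P P' : Quad (Set.univ : Set ℂ)), P'.carrier = P.carrier → P'.side 0 = P.side 0 → P'.side 1 = P.side 1 → P'.side 2 = P.side 2 → P'.side 3 = P.side 3 → QuadConfig.crossedEvent P' = QuadConfig.crossedEvent P :=
  Summit.CriticalPhenomena.CardyFormulaZ2.Cruxes.Z2LimitsSymmetric.stub_crossedEvent_eq_of_sides

/-- **S3e — `stub_selfDualMarginals_of` (M/L, the lead's stub): the assembly `S3a → S3b → S3d → S3`.**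
Coupling at mesh `δ`: `X = {i | Q_i ∈ S_ω}`, `Y = {i | Qt_i ∉ S'_ω}` with `S'_ω` the shifted dual configuration
(law `(translate (δ/2)(1+i))_* μ_δ`, since `dualConfig_* P_½ = P_½`); S3a gives `X ⊆ Y` pointwise, so
`|μ_δ(E_A) - ν_δ(F_A)| ≤ P[X ≠ Y] ≤ Σ_i (1 - ν_δ(⊞_{Qt_i}) - μ_δ(⊞_{Q_i}))`; along the defining meshes
`μ_δ → μ` and `ν_δ → μ` (`tendsto_map_translate_of_tendsto`), cylinder events are `μ`-continuity sets
(Lemma 5.1, `SchrammSmirnov2011_lemma_5_1_holds`, + `tendsto_measure_of_null_frontier_generateFrom`), and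
the right-hand side tends to `Σ_i (1 - μ(⊞_{Qt_i}) - μ(⊞_{Q_i})) ≤ 0` by S3b (charting `Q_i` with
`Quad.exists_homeomorph_extend`) and S3d (`⊞_{Qt_i} = ⊞_{Q_i†}`). -/
theorem stub_selfDualMarginals_of :
    open Literature.Probability.Percolation.QuadCrossing in (∀ (δ : ℝ), 0 < δ → ∀ (ω : Literature.Probability.Percolation.BondConfig (Literature.Probability.LatticeModels.Site 2)) (Q Qt : Quad (Set.univ : Set ℂ)), Qt.carrier = Q.carrier → Qt.side 0 = Q.side 1 → Qt.side 2 = Q.side 3 → Q ∈ Literature.Probability.Percolation.z2QuadConfig (Set.univ : Set ℂ) δ ω → Qt ∉ QuadConfig.translate (((δ / 2 : ℝ) : ℂ) * (1 + Complex.I)) (Literature.Probability.Percolation.z2QuadConfig (Set.univ : Set ℂ) δ (Literature.Probability.Percolation.dualConfig ω))) → (∀ μ ∈ Literature.Probability.Percolation.QuadCrossing.subseqQuadLimits (Set.univ : Set ℂ), ∀ H : ℂ ≃ₜ ℂ, (1 : ENNReal) ≤ ((μ : MeasureTheory.FiniteMeasure (QuadConfig (Set.univ : Set ℂ))) : MeasureTheory.Measure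 (QuadConfig (Set.univ : Set ℂ))) (QuadConfig.crossedEvent (Quad.rectQuad H 1 1 one_pos one_pos (fun _ => Set.mem_univ _))) + ((μ : MeasureTheory.FiniteMeasure (QuadConfig (Set.univ : Set ℂ))) : MeasureTheory.Measure (QuadConfig (Set.univ : Set ℂ))) (QuadConfig.crossedEvent (Quad.rectQuad ((Homeomorph.mulLeft₀ Complex.I Complex.I_ne_zero).trans H) 1 1 one_pos one_pos (fun _ => Set.mem_univ _)))) → (∀ (P P' : Quad (Set.univ : Set ℂ)), P'.carrier = P.carrier → P'.side 0 = P.side 0 → P'.side 1 = P.side 1 → P'.side 2 = P.side 2 → P'.side 3 = P.side 3 → QuadConfig.crossedEvent P' = QuadConfig.crossedEvent P) → ∀ μ ∈ subseqQuadLimits (Set.univ : Set ℂ), ∀ (n : ℕ) (Q Qt : Fin n → Quad (Set.univ : Set ℂ)), (∀ i, (Qt i).carrier = (Q i).carrier ∧ (Qt i).side 0 = (Q i).side 1 ∧ (Qt i).side 1 = (Q i).side 2 ∧ (Qt i).side 2 = (Q i).side 3 ∧ (Qt i).side 3 = (Q i).side 0) → ∀ A : Set (Set (Fin n)), ((μ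 : MeasureTheory.FiniteMeasure (QuadConfig (Set.univ : Set ℂ))) : MeasureTheory.Measure (QuadConfig (Set.univ : Set ℂ))) {S | {i | Q i ∈ S} ∈ A} = ((μ : MeasureTheory.FiniteMeasure (QuadConfig (Set.univ : Set ℂ))) : MeasureTheory.Measure (QuadConfig (Set.univ : Set ℂ))) {S | {i | Qt i ∉ S} ∈ A} :=
  Summit.CriticalPhenomena.CardyFormulaZ2.Cruxes.Z2LimitsSymmetric.stub_selfDualMarginals_of

/-- **S3 — `stub_selfDualMarginals` (registered at birth, now DERIVED): exact self-duality of the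
finite-dimensional crossing marginals of `ℤ²` sublimits**, from S3a, S3b, S3d via S3e. -/
theorem stub_selfDualMarginals :
    open Literature.Probability.Percolation.QuadCrossing in ∀ μ ∈ subseqQuadLimits (Set.univ : Set ℂ),
      ∀ (n : ℕ) (Q Qt : Fin n → Quad (Set.univ : Set ℂ)),
        (∀ i, (Qt i).carrier = (Q i).carrier ∧ (Qt i).side 0 = (Q i).side 1 ∧
          (Qt i).side 1 = (Q i).side 2 ∧ (Qt i).side 2 = (Q i).side 3 ∧
          (Qt i).side 3 = (Q i).side 0) →
        ∀ A : Set (Set (Fin n)),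
          ((μ : MeasureTheory.FiniteMeasure (QuadConfig (Set.univ : Set ℂ))) :
              MeasureTheory.Measure (QuadConfig (Set.univ : Set ℂ))) {S | {i | Q i ∈ S} ∈ A} =
            ((μ : MeasureTheory.FiniteMeasure (QuadConfig (Set.univ : Set ℂ))) :
              MeasureTheory.Measure (QuadConfig (Set.univ : Set ℂ))) {S | {i | Qt i ∉ S} ∈ A} :=
  stub_selfDualMarginals_of stub_dualExclusion stub_oneQuadDualityGe stub_crossedEvent_eq_of_sides

/-- **S4 — `stub_latticeRSWQuads` (M): Russo–Seymour–Welsh for rectangle quads, at lattice level, eventually in the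
mesh.**  ONE constant `c > 0` such that for every axis-parallel `3a × a` rectangle quad `Q` with sides `0`/`2` its
short edges, `c ≤ μ_δ(⊞_Q)` for all sufficiently small meshes `δ` (`rsw_half_holds`, PROVED in tree, at aspect
ratio `4`; box monotonicity `crossingProb_anti_left` / `crossingProb_mono_right`; translation invariance of `P_{1/2}`;
a sub-continuum of the drawn open left–right crossing of the slightly wider, slightly lower lattice box lies in `[Q]`
and joins `∂₀Q` to `∂₂Q`, so `Q ∈ S_ω`; `measurable_z2QuadConfig` makes `μ_δ` an honest push-forward).
Grimmett (1999) §11.7; SS11 §1.3. -/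
theorem stub_latticeRSWQuads :
    open Literature.Probability.Percolation.QuadCrossing in ∃ c : ℝ, 0 < c ∧ ∀ (a x y : ℝ), 0 < a → ∀ Q : Quad (Set.univ : Set ℂ),
      Q.carrier = {w : ℂ | x ≤ w.re ∧ w.re ≤ x + 3 * a ∧ y ≤ w.im ∧ w.im ≤ y + a} →
      Q.side 0 = {w : ℂ | w.re = x ∧ y ≤ w.im ∧ w.im ≤ y + a} →
      Q.side 2 = {w : ℂ | w.re = x + 3 * a ∧ y ≤ w.im ∧ w.im ≤ y + a} →
      ∀ᶠ δ in nhdsWithin (0 : ℝ) (Set.Ioi 0),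
        c ≤ ((Literature.Probability.Percolation.z2QuadLaw (Set.univ : Set ℂ) δ :
              MeasureTheory.FiniteMeasure (QuadConfig (Set.univ : Set ℂ))) :
            MeasureTheory.Measure (QuadConfig (Set.univ : Set ℂ))).real (QuadConfig.crossedEvent Q) :=
  Summit.CriticalPhenomena.CardyFormulaZ2.Cruxes.Z2LimitsSymmetric.stub_latticeRSWQuads

/-! ### Name-keyed aliases of the four statements

The hypotheses of the composition: the skeleton audit admits a hypothesis only if its head
constant is a registered obligation or is named like a declared stub.  Each alias repeats the
stub's signature verbatim (generated from one source). -/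
namespace Registered

/-- Alias of the statement of `stub_rotationInvariantLimits`, keyed by the registered stub name. -/
abbrev stub_rotationInvariantLimits : Prop :=
  open Literature.Probability.Percolation.QuadCrossing in ∀ μ ∈ subseqQuadLimits (Set.univ : Set ℂ), ∀ α : ℝ,
      isometryLaw (rotation (Circle.exp α)).toIsometryEquiv μ = μ

/-- Alias of the statement of `stub_isometryOfRotation`, keyed by the registered stub name. -/
abbrev stub_isometryOfRotation : Prop :=
  open Literature.Probability.Percolation.QuadCrossing in ∀ μ ∈ subseqQuadLimits (Set.univ : Set ℂ),
      (∀ α : ℝ, isometryLaw (rotation (Circle.exp α)).toIsometryEquiv μ = μ) →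
      ∀ g : ℂ ≃ᵢ ℂ, MeasureTheory.Measure.map (QuadConfig.isometry g)
        ((μ : MeasureTheory.FiniteMeasure (QuadConfig (Set.univ : Set ℂ))) :
          MeasureTheory.Measure (QuadConfig (Set.univ : Set ℂ))) =
        ((μ : MeasureTheory.FiniteMeasure (QuadConfig (Set.univ : Set ℂ))) :
          MeasureTheory.Measure (QuadConfig (Set.univ : Set ℂ)))

/-- Alias of the statement of `stub_dualExclusion`, keyed by the registered stub name. -/
abbrev stub_dualExclusion : Prop :=
  open Literature.Probability.Percolation.QuadCrossing in ∀ (δ : ℝ), 0 < δ → ∀ (ω : Literature.Probability.Percolation.BondConfig (Literature.Probability.LatticeModels.Site 2)) (Q Qt : Quad (Set.univ : Set ℂ)), Qt.carrier = Q.carrier → Qt.side 0 = Q.side 1 → Qt.side 2 = Q.side 3 → Q ∈ Literature.Probability.Percolation.z2QuadConfig (Set.univ : Set ℂ) δ ω → Qt ∉ QuadConfig.translate (((δ / 2 : ℝ) : ℂ) * (1 + Complex.I)) (Literature.Probability.Percolation.z2QuadConfig (Set.univ : Set ℂ) δ (Literature.Probability.Percolation.dualConfig ω))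

/-- Alias of the statement of `stub_oneQuadDualityGe`, keyed by the registered stub name. -/
abbrev stub_oneQuadDualityGe : Prop :=
  open Literature.Probability.Percolation.QuadCrossing in ∀ μ ∈ Literature.Probability.Percolation.QuadCrossing.subseqQuadLimits (Set.univ : Set ℂ), ∀ H : ℂ ≃ₜ ℂ, (1 : ENNReal) ≤ ((μ : MeasureTheory.FiniteMeasure (QuadConfig (Set.univ : Set ℂ))) : MeasureTheory.Measure (QuadConfig (Set.univ : Set ℂ))) (QuadConfig.crossedEvent (Quad.rectQuad H 1 1 one_pos one_pos (fun _ => Set.mem_univ _))) + ((μ : MeasureTheory.FiniteMeasure (QuadConfig (Set.univ : Set ℂ))) : MeasureTheory.Measure (QuadConfig (Set.univ : Set ℂ))) (QuadConfig.crossedEvent (Quad.rectQuad ((Homeomorph.mulLeft₀ Complex.I Complex.I_ne_zero).trans H) 1 1 one_pos one_pos (fun _ => Set.mem_univ _)))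

/-- Alias of the statement of `stub_crossedEvent_eq_of_sides`, keyed by the registered stub name. -/
abbrev stub_crossedEvent_eq_of_sides : Prop :=
  open Literature.Probability.Percolation.QuadCrossing in ∀ (P P' : Quad (Set.univ : Set ℂ)), P'.carrier = P.carrier → P'.side 0 = P.side 0 → P'.side 1 = P.side 1 → P'.side 2 = P.side 2 → P'.side 3 = P.side 3 → QuadConfig.crossedEvent P' = QuadConfig.crossedEvent P

/-- Alias of the statement of `stub_selfDualMarginals_of`, keyed by the registered stub name. -/
abbrev stub_selfDualMarginals_of : Prop :=
  open Literature.Probability.Percolation.QuadCrossing in (∀ (δ : ℝ), 0 < δ → ∀ (ω : Literature.Probability.Percolation.BondConfig (Literature.Probability.LatticeModels.Site 2)) (Q Qt : Quad (Set.univ : Set ℂ)), Qt.carrier = Q.carrier → Qt.side 0 = Q.side 1 → Qt.side 2 = Q.side 3 → Q ∈ Literature.Probability.Percolation.z2QuadConfig (Set.univ : Set ℂ) δ ω → Qt ∉ QuadConfig.translate (((δ / 2 : ℝ) : ℂ) * (1 + Complex.I)) (Literature.Probability.Percolation.z2QuadConfig (Set.univ : Set ℂ) δ (Literature.Probability.Percolation.dualConfig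 ω))) → (∀ μ ∈ Literature.Probability.Percolation.QuadCrossing.subseqQuadLimits (Set.univ : Set ℂ), ∀ H : ℂ ≃ₜ ℂ, (1 : ENNReal) ≤ ((μ : MeasureTheory.FiniteMeasure (QuadConfig (Set.univ : Set ℂ))) : MeasureTheory.Measure (QuadConfig (Set.univ : Set ℂ))) (QuadConfig.crossedEvent (Quad.rectQuad H 1 1 one_pos one_pos (fun _ => Set.mem_univ _))) + ((μ : MeasureTheory.FiniteMeasure (QuadConfig (Set.univ : Set ℂ))) : MeasureTheory.Measure (QuadConfig (Set.univ : Set ℂ))) (QuadConfig.crossedEvent (Quad.rectQuad ((Homeomorph.mulLeft₀ Complex.I Complex.I_ne_zero).trans H) 1 1 one_pos one_pos (fun _ => Set.mem_univ _)))) → (∀ (P P' : Quad (Set.univ : Set ℂ)), P'.carrier = P.carrier → P'.side 0 = P.side 0 → P'.side 1 = P.side 1 → P'.side 2 = P.side 2 → P'.side 3 = P.side 3 → QuadConfig.crossedEvent P' = QuadConfig.crossedEvent P) → ∀ μ ∈ subseqQuadLimits (Set.univ : Set ℂ), ∀ (n : ℕ) (Q Qt : Fin n → Quad (Set.univ : Set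 ℂ)), (∀ i, (Qt i).carrier = (Q i).carrier ∧ (Qt i).side 0 = (Q i).side 1 ∧ (Qt i).side 1 = (Q i).side 2 ∧ (Qt i).side 2 = (Q i).side 3 ∧ (Qt i).side 3 = (Q i).side 0) → ∀ A : Set (Set (Fin n)), ((μ : MeasureTheory.FiniteMeasure (QuadConfig (Set.univ : Set ℂ))) : MeasureTheory.Measure (QuadConfig (Set.univ : Set ℂ))) {S | {i | Q i ∈ S} ∈ A} = ((μ : MeasureTheory.FiniteMeasure (QuadConfig (Set.univ : Set ℂ))) : MeasureTheory.Measure (QuadConfig (Set.univ : Set ℂ))) {S | {i | Qt i ∉ S} ∈ A}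

/-- Alias of the statement of `stub_selfDualMarginals`, keyed by the registered stub name. -/
abbrev stub_selfDualMarginals : Prop :=
  open Literature.Probability.Percolation.QuadCrossing in ∀ μ ∈ subseqQuadLimits (Set.univ : Set ℂ),
      ∀ (n : ℕ) (Q Qt : Fin n → Quad (Set.univ : Set ℂ)),
        (∀ i, (Qt i).carrier = (Q i).carrier ∧ (Qt i).side 0 = (Q i).side 1 ∧
          (Qt i).side 1 = (Q i).side 2 ∧ (Qt i).side 2 = (Q i).side 3 ∧
          (Qt i).side 3 = (Q i).side 0) →
        ∀ A : Set (Set (Fin n)),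
          ((μ : MeasureTheory.FiniteMeasure (QuadConfig (Set.univ : Set ℂ))) :
              MeasureTheory.Measure (QuadConfig (Set.univ : Set ℂ))) {S | {i | Q i ∈ S} ∈ A} =
            ((μ : MeasureTheory.FiniteMeasure (QuadConfig (Set.univ : Set ℂ))) :
              MeasureTheory.Measure (QuadConfig (Set.univ : Set ℂ))) {S | {i | Qt i ∉ S} ∈ A}

/-- Alias of the statement of `stub_latticeRSWQuads`, keyed by the registered stub name. -/
abbrev stub_latticeRSWQuads : Prop :=
  open Literature.Probability.Percolation.QuadCrossing in ∃ c : ℝ, 0 < c ∧ ∀ (a x y : ℝ), 0 < a → ∀ Q : Quad (Set.univ : Set ℂ),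
      Q.carrier = {w : ℂ | x ≤ w.re ∧ w.re ≤ x + 3 * a ∧ y ≤ w.im ∧ w.im ≤ y + a} →
      Q.side 0 = {w : ℂ | w.re = x ∧ y ≤ w.im ∧ w.im ≤ y + a} →
      Q.side 2 = {w : ℂ | w.re = x + 3 * a ∧ y ≤ w.im ∧ w.im ≤ y + a} →
      ∀ᶠ δ in nhdsWithin (0 : ℝ) (Set.Ioi 0),
        c ≤ ((Literature.Probability.Percolation.z2QuadLaw (Set.univ : Set ℂ) δ :
              MeasureTheory.FiniteMeasure (QuadConfig (Set.univ : Set ℂ))) :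
            MeasureTheory.Measure (QuadConfig (Set.univ : Set ℂ))).real (QuadConfig.crossedEvent Q)

end Registered

/-! ### Portmanteau step: a lattice lower bound holding for all small meshes survives in every sublimit -/

/-- **Closed crossing events keep lattice lower bounds in the limit.**  If `μ ∈ Λ` and a real `c`
bounds `μ_δ(⊞_Q)` from below for all small `δ > 0`, then `c ≤ μ(⊞_Q)`: along the defining meshes
`δₖ → 0⁺` of `μ` (`isSubseqQuadLimit_iff`) the bound holds eventually, `⊞_Q` is closed in `𝒯`
(`QuadConfig.isClosed_crossedEvent`), and the closed-set half of the portmanteau theorem on the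
metrisable `ℋ_ℂ` (`QuadConfig.hasOuterApproxClosed`, `FiniteMeasure.limsup_measure_closed_le_of_tendsto`)
gives `limsup μ_{δₖ}(⊞_Q) ≤ μ(⊞_Q)`. -/
theorem le_measureReal_crossedEvent_of_eventually
    {μ : FiniteMeasure (QuadConfig (Set.univ : Set ℂ))} (hμ : μ ∈ subseqQuadLimits (Set.univ : Set ℂ))
    (Q : Quad (Set.univ : Set ℂ)) {c : ℝ}
    (h : ∀ᶠ δ in nhdsWithin (0 : ℝ) (Set.Ioi 0),
      c ≤ ((z2QuadLaw (Set.univ : Set ℂ) δ : FiniteMeasure (QuadConfig (Set.univ : Set ℂ))) :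
        Measure (QuadConfig (Set.univ : Set ℂ))).real (QuadConfig.crossedEvent Q)) :
    c ≤ (μ : Measure (QuadConfig (Set.univ : Set ℂ))).real (QuadConfig.crossedEvent Q) := by
  haveI : HasOuterApproxClosed (QuadConfig (Set.univ : Set ℂ)) :=
    QuadConfig.hasOuterApproxClosed isOpen_univ univ_nonempty
  obtain ⟨δs, hpos, hδ0, hlim⟩ := (isSubseqQuadLimit_iff Set.univ μ).mp hμ
  have hδs : Tendsto δs atTop (nhdsWithin (0 : ℝ) (Set.Ioi 0)) :=
    tendsto_nhdsWithin_iff.mpr ⟨hδ0, Eventually.of_forall fun k => hpos k⟩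
  -- the lower bound along the defining meshes, in `ℝ≥0∞`
  have hev : ∀ᶠ k in atTop, ENNReal.ofReal c ≤
      ((z2QuadLaw (Set.univ : Set ℂ) (δs k) : FiniteMeasure (QuadConfig (Set.univ : Set ℂ))) :
        Measure (QuadConfig (Set.univ : Set ℂ))) (QuadConfig.crossedEvent Q) := by
    filter_upwards [hδs.eventually h] with k hk
    exact (ENNReal.ofReal_le_iff_le_toReal (measure_ne_top _ _)).mpr hk
  -- closed-set portmanteau
  have hlimsup : atTop.limsup (fun k =>
      ((z2QuadLaw (Set.univ : Set ℂ) (δs k) : FiniteMeasure (QuadConfig (Set.univ : Set ℂ))) :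
        Measure (QuadConfig (Set.univ : Set ℂ))) (QuadConfig.crossedEvent Q)) ≤
      (μ : Measure (QuadConfig (Set.univ : Set ℂ))) (QuadConfig.crossedEvent Q) :=
    FiniteMeasure.limsup_measure_closed_le_of_tendsto hlim (QuadConfig.isClosed_crossedEvent Q)
  have hle : ENNReal.ofReal c ≤
      (μ : Measure (QuadConfig (Set.univ : Set ℂ))) (QuadConfig.crossedEvent Q) :=
    (le_limsup_of_frequently_le hev.frequently).trans hlimsup
  exact (ENNReal.ofReal_le_iff_le_toReal (measure_ne_top _ _)).mp hle

/-! ### The composition: the four stubs imply the crux, by name -/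

/-- **`Z2LimitsSymmetric` from S1 alone** (no `sorry` outside S1): (P) is the tree theorem
`isProbabilityMeasure_of_isSubseqQuadLimit`; (E2) is the landed S2 fed with S1; (D) is S3 = S3e(S3a, S3b, S3d),
all landed; (RSW) is the landed S4 through `le_measureReal_crossedEvent_of_eventually`, with the SAME constant `c`
for every `μ`.  The tree version is `Theorems/CardyMeckeFlipZ2LimitsSymmetric.lean`,
`Z2LimitsSymmetric_of_rotationInvariance` / `Z2LimitsSymmetric_of_dkkmo`. -/
theorem Z2LimitsSymmetric_of (h₁ : Registered.stub_rotationInvariantLimits) :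
    Summit.CriticalPhenomena.CardyFormulaZ2.Theses.CardyMeckeFlip.Z2LimitsSymmetric := by
  -- the six landed stubs, discharged inside the proof (only S1 remains a hypothesis)
  have h₂ : Registered.stub_isometryOfRotation := stub_isometryOfRotation
  have h₃ : Registered.stub_selfDualMarginals := stub_selfDualMarginals
  have h₄ : Registered.stub_latticeRSWQuads := stub_latticeRSWQuads
  intro μ hμ
  refine ⟨isProbabilityMeasure_of_isSubseqQuadLimit isOpen_univ hμ, h₂ μ hμ (h₁ μ hμ), h₃ μ hμ, ?_⟩
  obtain ⟨c, hc, hlat⟩ := h₄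
  exact ⟨c, hc, fun a x y ha Q hQc hQ0 hQ2 =>
    le_measureReal_crossedEvent_of_eventually hμ Q (hlat a x y ha Q hQc hQ0 hQ2)⟩

/-- Wiring check: the registered (sorried) stubs feed `Z2LimitsSymmetric_of` as stated.  An
`example`, so that `Z2LimitsSymmetric_of` stays the only named theorem of this file concluding
the crux. -/
example : Summit.CriticalPhenomena.CardyFormulaZ2.Theses.CardyMeckeFlip.Z2LimitsSymmetric :=
  Z2LimitsSymmetric_of stub_rotationInvariantLimits

/-- Wiring check for the derived S3: it is literally the birth-registered statement. -/
example : Registered.stub_selfDualMarginals := stub_selfDualMarginals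

end Summit.CriticalPhenomena.CardyFormulaZ2.Cruxes.Z2LimitsSymmetric.Birth

end
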